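import Summits.NavierStokesRegularity.NavierStokesRegularity.Theorems.EfficiencyFloorRigidExitSlice
import HarnessLib

/-!
# Route `EfficiencyFloor`, support `RigidExit` (stmt-25513) on the `ProductionEfficiencyDecay` ladder (stmt-22866):
# (RATE) FOR SINGLE-ORBIT TANGENT SEQUENCES — the compact-stabiliser slice, assembled

Helper file (`--supports stmt-NavierStokesRegularity-22866`; line `efficiency_floor`), assembling `…RigidExitSliceGroup` (group law,
compact stabiliser, one-parameter subgroups) and `…RigidExitSlice` (compactness modulo the stabiliser, `slice_core`) into the (RATE)
statement isolated in `…RigidExitTangentConeRate` — for sequences already lying in ONE symmetry orbit of the profile `m` (which is what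
clause (a) of `MaximiserSetRigidity` with `…OrbitClosed`/`…ScaleClock` provides):

* `rate_of_orbit`: for a continuous, differentiable profile `m` vanishing at infinity with `m ≢ 0`, orbit points
  `wₙ = λₙ Cₙ m(λₙ C'ₙ(· − aₙ))` (`λₙ > 0`, `C'ₙ Cₙ = Cₙ C'ₙ = I`, `Cₙ` inner-product preserving, `λₙ → 1`) whose difference quotients
  `τₙ⁻¹(wₙ(x) − m(x))` converge at every point (`τₙ ↓ 0`) admit, along a subsequence, orbit representatives OVER `m` whose parameter
  difference quotients `τ⁻¹(λ − 1)`, `τ⁻¹(C − I)`, `τ⁻¹(C' − I)`, `τ⁻¹ a` CONVERGE — exactly the format consumed by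
  `TangentCone.tangentCone_of_rate` / `tangent_of_boundedRate`.

So, granted orbit membership, the residue (RATE) of item (i) ORBIT SELECTION is discharged: pointwise orbit tangents at a profile are
infinitesimal symmetries. HONEST FRAMING: finite-dimensional analysis about a fixed profile; orbit membership (clause (a)), item (ii)
(uniform margin), `RigidExit`, `LerayFloorGap`, `ProductionEfficiencyDecay` (stmt-22866) and Navier–Stokes regularity stay OPEN; no
summit statement is proved. [folklore]
-/

-- the problem directory repeats the summit name (`NavierStokesRegularity/NavierStokesRegularity`)
set_option linter.dupNamespace false

noncomputable section

open Set Filter MeasureTheory Topology Function Bornology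
open scoped InnerProductSpace RealInnerProductSpace ENNReal NNReal
open Literature.Analysis.FluidPDE

namespace Summit.NavierStokesRegularity.NavierStokesRegularity.Theorems

namespace RigidExit

namespace Slice

open TangentCone OrbitClosed

/-! ## §4 (RATE) for single-orbit sequences -/

/-- **(RATE) for sequences in one symmetry orbit — the compact-stabiliser slice.** Let `m` be a continuous, differentiable profile
vanishing at infinity with `m x₀ ≠ 0`, and `wₙ = λₙ Cₙ m(λₙ C'ₙ(· − aₙ))` orbit points (`λₙ > 0`, `C'ₙ Cₙ = Cₙ C'ₙ = I`, `Cₙ`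
inner-product preserving) with `λₙ → 1`, `τₙ > 0`, `τₙ → 0` and `τₙ⁻¹(wₙ(x) − m(x)) → h(x)` for every `x`. Then along a subsequence the
`w_(φ n)` admit orbit representatives OVER `m` whose parameter difference quotients `τ⁻¹(λ − 1)`, `τ⁻¹(C − I)`, `τ⁻¹(C' − I)`, `τ⁻¹ a`
CONVERGE (the format of the hypothesis of `TangentCone.tangentCone_of_rate`). Mechanism: compactness modulo the stabiliser (§2),
distance-minimising representatives in the stabiliser cosets (compact stabiliser, `…SliceGroup`), and the slice (§3) — an unbounded
rate is impossible, a bounded one subconverges (Bolzano–Weierstrass in the parameter space). [folklore] -/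
theorem rate_of_orbit {m : EuclideanSpace ℝ (Fin 3) → EuclideanSpace ℝ (Fin 3)} (hmc : Continuous m) (hmd : Differentiable ℝ m)
    (hm0 : Tendsto m (cocompact (EuclideanSpace ℝ (Fin 3))) (𝓝 0)) {x₀ : EuclideanSpace ℝ (Fin 3)} (hx₀ : m x₀ ≠ 0)
    {lam : ℕ → ℝ} {C C' : ℕ → (EuclideanSpace ℝ (Fin 3) →L[ℝ] EuclideanSpace ℝ (Fin 3))} {a : ℕ → EuclideanSpace ℝ (Fin 3)} (hlam : ∀ n, 0 < lam n)
    (hinv : ∀ n v, C' n (C n v) = v) (hinv' : ∀ n v, C n (C' n v) = v)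
    (hiso : ∀ n (v w : EuclideanSpace ℝ (Fin 3)), ⟪C n v, C n w⟫_ℝ = ⟪v, w⟫_ℝ) (hlam1 : Tendsto lam atTop (𝓝 1))
    {τ : ℕ → ℝ} (hτ : ∀ n, 0 < τ n) (hτ0 : Tendsto τ atTop (𝓝 0)) {h : EuclideanSpace ℝ (Fin 3) → EuclideanSpace ℝ (Fin 3)}
    (hh : ∀ x, Tendsto (fun n => (τ n)⁻¹ • (lam n • C n (m (lam n • C' n (x - a n))) - m x)) atTop (𝓝 (h x))) :
    ∃ (φ : ℕ → ℕ) (lam₂ : ℕ → ℝ) (D D' : ℕ → (EuclideanSpace ℝ (Fin 3) →L[ℝ] EuclideanSpace ℝ (Fin 3))) (a₂ : ℕ → EuclideanSpace ℝ (Fin 3)) (l' : ℝ) (Rd Rd' : (EuclideanSpace ℝ (Fin 3) →L[ℝ] EuclideanSpace ℝ (Fin 3))) (ad : EuclideanSpace ℝ (Fin 3)),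
      StrictMono φ ∧ (∀ n v, D' n (D n v) = v) ∧ (∀ n (v v' : EuclideanSpace ℝ (Fin 3)), ⟪D n v, D n v'⟫_ℝ = ⟪v, v'⟫_ℝ) ∧
      (∀ n, (fun x => lam (φ n) • C (φ n) (m (lam (φ n) • C' (φ n) (x - a (φ n))))) =
        fun x => lam₂ n • D n (m (lam₂ n • D' n (x - a₂ n)))) ∧
      Tendsto (fun n => (τ (φ n))⁻¹ * (lam₂ n - 1)) atTop (𝓝 l') ∧
      Tendsto (fun n => (τ (φ n))⁻¹ • (D n - ContinuousLinearMap.id ℝ (EuclideanSpace ℝ (Fin 3)))) atTop (𝓝 Rd) ∧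
      Tendsto (fun n => (τ (φ n))⁻¹ • (D' n - ContinuousLinearMap.id ℝ (EuclideanSpace ℝ (Fin 3)))) atTop (𝓝 Rd') ∧
      Tendsto (fun n => (τ (φ n))⁻¹ • a₂ n) atTop (𝓝 ad) := by
  set e : ℝ × ((EuclideanSpace ℝ (Fin 3) →L[ℝ] EuclideanSpace ℝ (Fin 3)) × ((EuclideanSpace ℝ (Fin 3) →L[ℝ] EuclideanSpace ℝ (Fin 3)) × EuclideanSpace ℝ (Fin 3))) := ((1 : ℝ), ((1 : (EuclideanSpace ℝ (Fin 3) →L[ℝ] EuclideanSpace ℝ (Fin 3))), ((1 : (EuclideanSpace ℝ (Fin 3) →L[ℝ] EuclideanSpace ℝ (Fin 3))), (0 : EuclideanSpace ℝ (Fin 3))))) with he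
  -- pointwise convergence of the orbit points
  have hptw : ∀ x, Tendsto (fun n => lam n • C n (m (lam n • C' n (x - a n)))) atTop (𝓝 (m x)) := by
    intro x
    have h1 := tendsto_zero_of_rate (x := fun n => lam n • C n (m (lam n • C' n (x - a n))) - m x) (L := h x) hτ0 (hh x)
      (fun n => (hτ n).ne')
    have h2 := h1.add_const (m x)
    rw [zero_add] at h2
    exact h2.congr fun n => by simp only [sub_add_cancel]
  obtain ⟨φ₀, C₀, C₀', a₀, hφ₀, h0inv, h0inv', h0iso, h0fix, hC0, hC0', ha0⟩ :=
    exists_subseq_tendsto_stabiliser hmc hm0 hx₀ hlam hinv hinv' hiso hlam1 hptw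
  -- the (compact) stabiliser
  set S : Set (ℝ × ((EuclideanSpace ℝ (Fin 3) →L[ℝ] EuclideanSpace ℝ (Fin 3)) × ((EuclideanSpace ℝ (Fin 3) →L[ℝ] EuclideanSpace ℝ (Fin 3)) × EuclideanSpace ℝ (Fin 3)))) := {q : ℝ × ((EuclideanSpace ℝ (Fin 3) →L[ℝ] EuclideanSpace ℝ (Fin 3)) × ((EuclideanSpace ℝ (Fin 3) →L[ℝ] EuclideanSpace ℝ (Fin 3)) × EuclideanSpace ℝ (Fin 3))) | q.1 = 1 ∧ (∀ v, q.2.2.1 (q.2.1 v) = v) ∧ (∀ v, q.2.1 (q.2.2.1 v) = v) ∧ (∀ v w : EuclideanSpace ℝ (Fin 3), ⟪q.2.1 v, q.2.1 w⟫_ℝ = ⟪v, w⟫_ℝ) ∧ ∀ x, q.1 • q.2.1 (m (q.1 • q.2.2.1 (x - q.2.2.2))) = m x} with hSdef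
  have hS : IsCompact S := isCompact_stabiliser hmc hm0 hx₀
  have heS : e ∈ S := by
    refine ⟨rfl, fun v => ?_, fun v => ?_, fun v w => ?_, fun x => ?_⟩ <;>
      simp [he, one_apply_eq_self]
  -- the original parameters along `φ₀`, the minimising stabiliser corrections, the new representatives
  set g : ℕ → ℝ × ((EuclideanSpace ℝ (Fin 3) →L[ℝ] EuclideanSpace ℝ (Fin 3)) × ((EuclideanSpace ℝ (Fin 3) →L[ℝ] EuclideanSpace ℝ (Fin 3)) × EuclideanSpace ℝ (Fin 3))) := fun n => (lam (φ₀ n), (C (φ₀ n), (C' (φ₀ n), a (φ₀ n)))) with hg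
  have hcont : ∀ n, Continuous fun q : ℝ × ((EuclideanSpace ℝ (Fin 3) →L[ℝ] EuclideanSpace ℝ (Fin 3)) × ((EuclideanSpace ℝ (Fin 3) →L[ℝ] EuclideanSpace ℝ (Fin 3)) × EuclideanSpace ℝ (Fin 3))) => ‖((g n).1 * q.1, ((g n).2.1 * q.2.1, (q.2.2.1 * (g n).2.2.1, (g n).2.2.2 + (g n).1⁻¹ • (g n).2.1 q.2.2.2))) - e‖ := by
    intro n
    refine Continuous.norm (Continuous.sub ?_ continuous_const)
    exact (continuous_const.mul continuous_fst).prodMk ((continuous_const.mul continuous_snd.fst).prodMk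
      ((continuous_snd.snd.fst.mul continuous_const).prodMk
        (continuous_const.add ((continuous_const.clm_apply continuous_snd.snd.snd).fun_const_smul _))))
  have hexmin : ∀ n, ∃ s ∈ S, IsMinOn (fun q : ℝ × ((EuclideanSpace ℝ (Fin 3) →L[ℝ] EuclideanSpace ℝ (Fin 3)) × ((EuclideanSpace ℝ (Fin 3) →L[ℝ] EuclideanSpace ℝ (Fin 3)) × EuclideanSpace ℝ (Fin 3))) => ‖((g n).1 * q.1, ((g n).2.1 * q.2.1, (q.2.2.1 * (g n).2.2.1, (g n).2.2.2 + (g n).1⁻¹ • (g n).2.1 q.2.2.2))) - e‖) S s :=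
    fun n => hS.exists_isMinOn ⟨e, heS⟩ (hcont n).continuousOn
  choose s hsS hsmin using hexmin
  set G : ℕ → ℝ × ((EuclideanSpace ℝ (Fin 3) →L[ℝ] EuclideanSpace ℝ (Fin 3)) × ((EuclideanSpace ℝ (Fin 3) →L[ℝ] EuclideanSpace ℝ (Fin 3)) × EuclideanSpace ℝ (Fin 3))) := fun n => ((g n).1 * (s n).1, ((g n).2.1 * (s n).2.1, ((s n).2.2.1 * (g n).2.2.1, (g n).2.2.2 + (g n).1⁻¹ • (g n).2.1 (s n).2.2.2))) with hG
  have hGinv : ∀ n v, (G n).2.2.1 ((G n).2.1 v) = v := fun n v => by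
    simp only [hG, hg, mul_apply_eq_comp, hinv, (hsS n).2.1]
  have hGiso : ∀ n (v w : EuclideanSpace ℝ (Fin 3)), ⟪(G n).2.1 v, (G n).2.1 w⟫_ℝ = ⟪v, w⟫_ℝ := fun n v w => by
    simp only [hG, hg, mul_apply_eq_comp, hiso, (hsS n).2.2.2.1]
  have hrep : ∀ n x, lam (φ₀ n) • C (φ₀ n) (m (lam (φ₀ n) • C' (φ₀ n) (x - a (φ₀ n)))) =
      (G n).1 • (G n).2.1 (m ((G n).1 • (G n).2.2.1 (x - (G n).2.2.2))) := by
    intro n x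
    simp only [hG, hg]
    rw [orb_comp m (hlam _).ne' (s n).1 (hinv (φ₀ n)) (s n).2.1 (s n).2.2.1 (a (φ₀ n)) (s n).2.2.2 x,
      (hsS n).2.2.2.2 (lam (φ₀ n) • C' (φ₀ n) (x - a (φ₀ n)))]
  -- the representatives converge to the identity (compare with the correction by the limit stabiliser element)
  have hGe : Tendsto G atTop (𝓝 e) := by
    set si : ℝ × ((EuclideanSpace ℝ (Fin 3) →L[ℝ] EuclideanSpace ℝ (Fin 3)) × ((EuclideanSpace ℝ (Fin 3) →L[ℝ] EuclideanSpace ℝ (Fin 3)) × EuclideanSpace ℝ (Fin 3))) := ((1 : ℝ), (C₀', (C₀, -(C₀' a₀)))) with hsi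
    have hsiS : si ∈ S := by
      refine ⟨rfl, fun v => h0inv' v, fun v => h0inv v, fun v w => inner_map_inv h0inv' h0iso v w, fun x => ?_⟩
      show (1 : ℝ) • C₀' (m ((1 : ℝ) • C₀ (x - -(C₀' a₀)))) = m x
      rw [one_smul, one_smul, sub_neg_eq_add, map_add, h0inv' a₀]
      have := h0fix (C₀ x + a₀)
      rw [add_sub_cancel_right, h0inv] at this
      rw [← this, h0inv]
    have hbound : ∀ n, ‖G n - e‖ ≤ ‖((g n).1 * si.1, ((g n).2.1 * si.2.1, (si.2.2.1 * (g n).2.2.1, (g n).2.2.2 + (g n).1⁻¹ • (g n).2.1 si.2.2.2))) - e‖ := fun n => hsmin n (hsiS)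
    have h1 : (C₀ : (EuclideanSpace ℝ (Fin 3) →L[ℝ] EuclideanSpace ℝ (Fin 3))) * C₀' = 1 := ContinuousLinearMap.ext fun v => by
      rw [mul_apply_eq_comp, one_apply_eq_self, h0inv']
    have hl : Tendsto (fun n => lam (φ₀ n)) atTop (𝓝 1) := hlam1.comp hφ₀.tendsto_atTop
    have t1 : Tendsto (fun n => lam (φ₀ n) * (1 : ℝ)) atTop (𝓝 1) := by simpa using hl
    have t2 : Tendsto (fun n => C (φ₀ n) * C₀') atTop (𝓝 1) := by
      have := hC0.mul (tendsto_const_nhds (x := C₀'))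
      rwa [h1] at this
    have t3 : Tendsto (fun n => C₀ * C' (φ₀ n)) atTop (𝓝 1) := by
      have := (tendsto_const_nhds (x := C₀)).mul hC0'
      rwa [h1] at this
    have t4 : Tendsto (fun n => a (φ₀ n) + (lam (φ₀ n))⁻¹ • C (φ₀ n) (-(C₀' a₀))) atTop (𝓝 0) := by
      have := ha0.add ((hl.inv₀ one_ne_zero).smul (tendsto_clm_apply hC0 (tendsto_const_nhds (x := -(C₀' a₀)))))
      rwa [inv_one, one_smul, map_neg, h0inv', add_neg_cancel] at this
    have hlim : Tendsto (fun n => ((g n).1 * si.1, ((g n).2.1 * si.2.1, (si.2.2.1 * (g n).2.2.1, (g n).2.2.2 + (g n).1⁻¹ • (g n).2.1 si.2.2.2)))) atTop (𝓝 e) := by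
      have := t1.prodMk_nhds (t2.prodMk_nhds (t3.prodMk_nhds t4))
      exact this.congr fun n => rfl
    have hn := tendsto_iff_norm_sub_tendsto_zero.1 hlim
    refine tendsto_iff_norm_sub_tendsto_zero.2 ?_
    exact squeeze_zero (fun n => norm_nonneg _) hbound hn
  -- minimality over the whole coset
  have hassoc : ∀ n (q : ℝ × ((EuclideanSpace ℝ (Fin 3) →L[ℝ] EuclideanSpace ℝ (Fin 3)) × ((EuclideanSpace ℝ (Fin 3) →L[ℝ] EuclideanSpace ℝ (Fin 3)) × EuclideanSpace ℝ (Fin 3)))), ((g n).1 * (((s n).1 * q.1, ((s n).2.1 * q.2.1, (q.2.2.1 * (s n).2.2.1, (s n).2.2.2 + (s n).1⁻¹ • (s n).2.1 q.2.2.2)))).1, ((g n).2.1 * (((s n).1 * q.1, ((s n).2.1 * q.2.1, (q.2.2.1 * (s n).2.2.1, (s n).2.2.2 + (s n).1⁻¹ • (s n).2.1 q.2.2.2)))).2.1, ((((s n).1 * q.1, ((s n).2.1 * q.2.1, (q.2.2.1 * (s n).2.2.1, (s n).2.2.2 + (s n).1⁻¹ • (s n).2.1 q.2.2.2)))).2.2.1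 * (g n).2.2.1, (g n).2.2.2 + (g n).1⁻¹ • (g n).2.1 (((s n).1 * q.1, ((s n).2.1 * q.2.1, (q.2.2.1 * (s n).2.2.1, (s n).2.2.2 + (s n).1⁻¹ • (s n).2.1 q.2.2.2)))).2.2.2))) = ((G n).1 * q.1, ((G n).2.1 * q.2.1, (q.2.2.1 * (G n).2.2.1, (G n).2.2.2 + (G n).1⁻¹ • (G n).2.1 q.2.2.2))) := by
    intro n q
    simp only [hG]
    refine Prod.ext ?_ (Prod.ext ?_ (Prod.ext ?_ ?_)) <;>
      simp only [mul_assoc, map_add, map_smul, smul_add, smul_smul, mul_apply_eq_comp, mul_inv, add_assoc]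
  have hmin : ∀ n, ∀ q ∈ S, ‖G n - e‖ ≤ ‖((G n).1 * q.1, ((G n).2.1 * q.2.1, (q.2.2.1 * (G n).2.2.1, (G n).2.2.2 + (G n).1⁻¹ • (G n).2.1 q.2.2.2))) - e‖ := by
    intro n q hq
    have h1 := isMinOn_iff.1 (hsmin n) _ (mul_mem_stabiliser (hsS n) hq)
    simp only [] at h1
    rw [hassoc n q] at h1
    simpa only [hG] using h1
  -- the rate sequence: bounded (conclude) or unbounded (slice contradiction)
  have hnorm : ∀ n, ‖(τ (φ₀ n))⁻¹ • (G n - e)‖ = (τ (φ₀ n))⁻¹ * ‖G n - e‖ := fun n => by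
    rw [norm_smul, norm_inv, Real.norm_of_nonneg (hτ _).le]
  by_cases hb : ∃ R : ℝ, ∀ n, ‖(τ (φ₀ n))⁻¹ • (G n - e)‖ ≤ R
  · obtain ⟨R, hR⟩ := hb
    obtain ⟨ζ, -, φ₁, hφ₁, hζ⟩ := tendsto_subseq_of_bounded (Metric.isBounded_closedBall (x := (0 : ℝ × ((EuclideanSpace ℝ (Fin 3) →L[ℝ] EuclideanSpace ℝ (Fin 3)) × ((EuclideanSpace ℝ (Fin 3) →L[ℝ] EuclideanSpace ℝ (Fin 3)) × EuclideanSpace ℝ (Fin 3))))) (r := R))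
      (x := fun n => (τ (φ₀ n))⁻¹ • (G n - e)) (fun n => by rw [Metric.mem_closedBall, dist_zero_right]; exact hR n)
    refine ⟨φ₀ ∘ φ₁, fun n => (G (φ₁ n)).1, fun n => (G (φ₁ n)).2.1, fun n => (G (φ₁ n)).2.2.1, fun n => (G (φ₁ n)).2.2.2,
      ζ.1, ζ.2.1, ζ.2.2.1, ζ.2.2.2, hφ₀.comp hφ₁, fun n v => hGinv _ v, fun n v v' => hGiso _ v v',
      fun n => funext fun x => hrep (φ₁ n) x, ?_, ?_, ?_, ?_⟩
    · refine ((continuous_fst.tendsto _).comp hζ).congr fun n => ?_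
      simp only [Function.comp_apply, he, Prod.smul_fst, Prod.fst_sub, smul_eq_mul]
    · refine ((continuous_snd.fst.tendsto _).comp hζ).congr fun n => ?_
      simp only [Function.comp_apply, he, Prod.smul_fst, Prod.smul_snd, Prod.fst_sub, Prod.snd_sub]
      rfl
    · refine ((continuous_snd.snd.fst.tendsto _).comp hζ).congr fun n => ?_
      simp only [Function.comp_apply, he, Prod.smul_fst, Prod.smul_snd, Prod.fst_sub, Prod.snd_sub]
      rfl
    · refine ((continuous_snd.snd.snd.tendsto _).comp hζ).congr fun n => ?_
      simp only [Function.comp_apply, he, Prod.smul_snd, Prod.snd_sub, sub_zero]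
  · exfalso
    obtain ⟨ψ, hψ, hψpos, hψlim⟩ := exists_subseq_tendsto_atTop_of_not_bdd hb
    have hpos : ∀ k, 0 < ‖G (ψ k) - e‖ := by
      intro k
      have h0 : (0 : ℝ) < (τ (φ₀ (ψ k)))⁻¹ * ‖G (ψ k) - e‖ := by
        rw [← hnorm]
        exact lt_of_le_of_lt (Nat.cast_nonneg k) (hψpos k)
      exact (mul_pos_iff_of_pos_left (inv_pos.2 (hτ _))).1 h0
    refine slice_core hmc hmd hm0 hx₀ (G := fun k => G (ψ k)) (fun k v => hGinv (ψ k) v) (fun k v w => hGiso (ψ k) v w)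
      (hGe.comp hψ.tendsto_atTop) hpos (fun k => hmin (ψ k)) (T := fun k => τ (φ₀ (ψ k))) (fun k => hτ _)
      (hψlim.congr fun k => hnorm (ψ k)) (h := h) fun x => ?_
    refine ((hh x).comp ((hφ₀.comp hψ).tendsto_atTop)).congr fun k => ?_
    simp only [Function.comp_apply, hrep (ψ k) x]

end Slice

end RigidExit

end Summit.NavierStokesRegularity.NavierStokesRegularity.Theorems
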